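import Mathlib
import HarnessLib
import Summits.HubbardSuperconductivity.HubbardSuperconductivity.Theorems.KLProgrammeKLRegimeOverlapWtPairTel
import Summits.HubbardSuperconductivity.HubbardSuperconductivity.Theorems.KLProgrammeKLRegimeOverlapWtFlowAll

/-!
# K3 ENGINE child (stmt-HubbardSuperconductivity-20437), stub (b) (ℓ)/(I2), located item «(I2)-WT-WINDOW» (X2): the WEIGHTED overlap / re-sectorisation
# constants of the GENERAL JUMP `E(klAnisoFamily J′[K_n])·S(F̃_k[K_n])` AT THE FLOW FRAME WITH NO DEPTH WINDOW — every `k + 1 ≤ J′ ≤ n`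

Cell `gate-hubbard-kl`, seat p4 g17 (design: k3c3-p2 g13 I2-WT-WINDOW-DESIGN (X2); concur k3c2-p3 g12).  p3's `overlapWt_jump_sums_klEng_flow_deep (d)`
(…SectorMultiplierOverlapWtFlowDeep) binds the deep window `4ⁿ·U ≤ 4^{2(k+1)+d}` because its neighbouring character sums are keyed by the order-three datum of
`K_n` at the COARSEST level `k + 1`.  The assembly `overlapWt_jump_sums_le_of_nbWindow` only needs, at every level `m ∈ [k+1, J′]`, the neighbouring
thin × thin character sum with the weight of rate `Λ_{J′} ≤ Λ_m`; so it suffices to have each level's OWN-rate sum window-free, and that is a PER-LEVEL case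
split (W5's device one level down): if level `m` is deep at `K_n` (`4ⁿ·U ≤ 4^{2m+5}`) p3's datum route applies at `K_n` directly
(`frameDatumAt_le_of_pow_window`); otherwise the character-sum telescope `charSumWt_nbPair_klEng_meanFreeFinal 5 R c″` (…OverlapWtPairTel) from the base index
`m₀ := Nat.findGreatest (4^{·}U ≤ 4^{2m+5}) n` (`exists_overlap_base_index_of_not_window`), read at `K_n` through the model congruence
(`klAnisoFamily_congr`, `eval_fsub_symInterp_sum_Ico_self`):

* **`charSumWt_nbPair_klEng_flow_all (R) (c″)`** — `∃ C_T > 0`: W5's binder list (stub-(b) binders + `c″U ≤ 1`, `1 ≤ n ≤ n_β + 1`, `IsKLRegime U cc (−n)`,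
  `HistP … 0 n`, the REGISTERED (K5′) clauses `∀ m, 1 ≤ m → m < n → FlowPieceOscAt … c″ … m`), for EVERY `k + 1 ≤ n` and every sector pair: the
  `Λ_{k+1}`-rate weighted character sum of `F_{k+1,ω}[K_n]·F_{k,a′}[K_n]` is `≤ C_T·M·L²` — NO window;
* **`overlapWt_jump_sums_klEng_flow_all (R) (c″)`** — `∃ C_J > 0`: same binders, for every `k + 1 ≤ J′ ≤ n`: p3's THREE jump clauses at `K_n` (weighted rows
  `≤ 81·C_J·M/β`, the two per-sector position sums `≤ 3·C_J·M/β`), weight rate `J′` — the window-free twin of `overlapWt_jump_sums_klEng_flow_deep`, to which the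
  three weighted (I2) consumers (…TowerRemeasureWt §3/§4, …NarrowWideSplitWt, …ModelDefsWtFull §2) and the `_abs` rows (…TowerRemeasureWtAbs, …TowerRemeasureSum)
  re-key (X3).

The constants depend on `(R, c″)` only through the explicit factor `c″ + Gfr₁ + Gfr₂ + Gfr₃ + 1` of the x-free telescope part.  No definitions, no sorry.
Nothing asserts any stub, K3 or superconductivity. [cite: BenfattoGiulianiMastropietro2006, §2.7 (2.71a), §2.8 (2.77), (2.82)–(2.83), §3 (3.2)–(3.8)]
-/

noncomputable section

namespace Summit.HubbardSuperconductivity.HubbardSuperconductivity.Theorems.TorusFourierL2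

set_option linter.dupNamespace false -- summit = problem name (single-conjunct summit), D-0017

open Set Finset Literature.MathematicalPhysics.QuantumLattice Literature.MathematicalPhysics.QuantumLattice.BandSectorCounting
open Literature.MathematicalPhysics.QuantumLattice.FermiRG Literature.Probability.LatticeModels Literature.Analysis.SpecialFunctions
open Summit.HubbardSuperconductivity.HubbardSuperconductivity.Theorems.DispersionFlow
open Summit.HubbardSuperconductivity.HubbardSuperconductivity.Theorems.KLRegimeSplit
open Summit.HubbardSuperconductivity.HubbardSuperconductivity.Theorems.KLProgrammeLegKernels
open Summit.HubbardSuperconductivity.HubbardSuperconductivity.Theorems.PerturbedFermiCurve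
open scoped Real Nat

open Classical

/-! ## §1 The own-rate neighbouring character sum at the flow frame, every level, no window -/

set_option maxHeartbeats 1600000 in -- long regime bookkeeping, two routes
/-- **The `Λ_{k+1}`-rate weighted neighbouring thin × thin character sum at the flow frame `K_n`, EVERY level `k + 1 ≤ n`, NO depth window** (see the module
docstring): deep levels by p3's datum route at `K_n`, coarse levels by the mean-free character-sum telescope.
[cite: BenfattoGiulianiMastropietro2006, §2.7 (2.71a), §2.8 (2.77), §3 (3.2)–(3.8)] -/
theorem charSumWt_nbPair_klEng_flow_all (R : RenConsts) (c'' : ℝ) (hc'' : 0 ≤ c'') :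
    ∃ CT : ℝ, 0 < CT ∧
      ∀ (G : GeoConsts) (P : SplitConsts) (Q : EngConsts) (cc : ℝ), R.WF2 → 0 < cc → cc ≤ EngineV8.klEngC₃6 P R →
      ∀ μ ∈ klWindowC, ∀ U : ℝ, 0 < U → U ≤ min (EngineV8.klEngU₀3 P R cc) (1 / (R.Gfr 3 + 1)) → c'' * U ≤ 1 →
      ∀ β : ℝ, klBetaMin ≤ β → β ≤ Real.exp (cc / U ^ 2) →
      ∀ (L M : ℕ) [NeZero L] [NeZero M], EngineV8.klEngL₃ β U ≤ L → EngineV8.klEngM₃ β U L ≤ M →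
      ∀ n : ℕ, 1 ≤ n → n ≤ nScales β + 1 → IsKLRegime U cc (-(n : ℤ)) → HistP klPredsV17F2 L M G P Q R β U μ 0 n →
        (∀ m, 1 ≤ m → m < n → FlowPieceOscAt L M c'' β U μ m) →
        ∀ k : ℕ, k + 1 ≤ n → ∀ (ω : Fin (sectorCount (k + 1))) (a' : Fin (sectorCount k)),
        ∑ z : TorusSite 1 (2 * M) × TorusSite 2 L,
          (1 + klScale klE0 (k + 1) * β / (2 * M) * |(((z.1 0).valMinAbs : ℤ) : ℝ)| + klScale klE0 (k + 1) * |(((z.2 0).valMinAbs : ℤ) : ℝ)| +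
              klScale klE0 (k + 1) * |(((z.2 1).valMinAbs : ℤ) : ℝ)|) *
          ‖∑ q : TorusSite 1 (2 * M) × TorusSite 2 L, (torusChar q.1 z.1 * torusChar q.2 z.2) •
            (klAnisoFamily L M β μ (klFlowFrameU L M β U μ n) klE0 (k + 1) ω (⟨(q.1 0).val, ZMod.val_lt (q.1 0)⟩, q.2) *
              klAnisoFamily L M β μ (klFlowFrameU L M β U μ n) klE0 k a' (⟨(q.1 0).val, ZMod.val_lt (q.1 0)⟩, q.2))‖ ≤ CT * M * (L : ℝ) ^ 2 := by
  have ha : (-4 : ℝ) < -(6 / 5) := by norm_num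
  have hab : (-(6 / 5) : ℝ) ≤ -(1 / 10) := by norm_num
  have hb : (-(1 / 10) : ℝ) < 0 := by norm_num
  obtain ⟨CTd, hCTd, hdeep⟩ := charSumWt_klAnisoPair_nb_of_thresholds ha hab hb ((4 : ℝ) ^ 5 / 3072)
  obtain ⟨CTt, hCTt, htel⟩ := charSumWt_nbPair_klEng_meanFreeFinal 5 R c'' hc''
  refine ⟨CTd + CTt, by positivity, ?_⟩
  intro G P Q cc hR2 hcc hcc6 μ hμ U hU hUle hcU β hβmin hβc L M _ _ hL3 hM3 n hn1 hnN hreg hhist hosc k hkn ω a'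
  have hRj : ∀ j, 0 ≤ R.Gfr j := EngineV8.gfr_nonneg_of_wf2 hR2
  have hβ0 : 0 < β := pos_of_klBetaMin_le hβmin
  have hL0 : (0 : ℝ) < L := Nat.cast_pos.2 (Nat.pos_of_ne_zero (NeZero.ne L))
  have hM0 : (0 : ℝ) < M := Nat.cast_pos.2 (Nat.pos_of_ne_zero (NeZero.ne M))
  have hcle := (hcc6.trans (EngineV8.klEngC₃6_le_klEngC₃3 P R)).trans (EngineV8.klEngC₃3_le_symbolC₃ ha hab hb P hRj)
  have hU3E : U ≤ EngineV8.klEngU₀3 P R cc := hUle.trans (min_le_left _ _)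
  have hU3 := hU3E.trans (EngineV8.klEngU₀3_le_symbolU₀ ha hab hb P hRj cc)
  have hU1 : U ≤ 1 := hU3.trans (min_le_left _ _)
  have hUG : U ≤ 1 / (R.Gfr 3 + 1) := hUle.trans (min_le_right _ _)
  have hLβ : β ^ 2 ≤ (L : ℝ) := EngineV8.sq_le_of_klEngL₃_le hL3
  have hMβ : β ≤ (M : ℝ) := EngineV8.le_of_klEngM₃_le hβmin hL3 hM3
  have hML0 : 0 ≤ (M : ℝ) * (L : ℝ) ^ 2 := by positivity
  have hmonoD : CTd * M * (L : ℝ) ^ 2 ≤ (CTd + CTt) * M * (L : ℝ) ^ 2 := by nlinarith only [hML0, hCTt]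
  have hmonoT : CTt * M * (L : ℝ) ^ 2 ≤ (CTd + CTt) * M * (L : ℝ) ^ 2 := by nlinarith only [hML0, hCTd]
  by_cases hwin : (4 : ℝ) ^ n * U ≤ (4 : ℝ) ^ (2 * (k + 1) + 5)
  · -- the level is deep at `K_n`: p3's datum route at the flow frame
    set K : TrigPolyC4v := klFlowFrameU L M β U μ n with hKdef
    have hfr : FrameOK R U (nScales β) μ K := frameOK_klFlowFrameU_of_histP_le hR2 hn1 le_rfl hnN hhist
    obtain ⟨N, rfl⟩ : ∃ N, n = N + 1 := ⟨n - 1, by omega⟩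
    have hh := (histP_klPredsV17F2_iff L M G P Q R β U μ 0 (N + 1)).1 hhist
    have hJets : ∀ m ≤ N, FlowPieceJetsAt L M β U μ R m := fun m hm => (hh m (Nat.lt_succ_of_le hm)).2.1.2.1
    have hGeo : FlowGeometryAt L M β U μ N := (hh N (Nat.lt_succ_self N)).2.1.2.2
    have hK1 : FrameOK R U N μ K := frameOK_klFlowFrameU_succ hJets hGeo
    have hA3 : ∀ p : Momentum, ‖iteratedFDeriv ℝ 3 (frameShift K) p‖ ≤ R.Gfr 3 * U ^ 2 * ((4 : ℝ) ^ (N + 1) / 3) :=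
      (frameShift_high_sizes_of_frameOK hRj hK1).1
    have hGU : R.Gfr 3 * U ≤ 1 := by
      have hG3 := hRj 3
      calc R.Gfr 3 * U ≤ R.Gfr 3 * (1 / (R.Gfr 3 + 1)) := mul_le_mul_of_nonneg_left hUG hG3
        _ = R.Gfr 3 / (R.Gfr 3 + 1) := by ring
        _ ≤ 1 := by rw [div_le_one (by positivity)]; linarith only [hG3]
    have hdat : R.Gfr 3 * U ^ 2 * ((4 : ℝ) ^ (N + 1) / 3) * klScale klE0 (k + 1) ^ 2 ≤ (4 : ℝ) ^ 5 / 3072 :=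
      frameDatumAt_le_of_pow_window hU.le hGU le_rfl hwin
    have hbd := hdeep R hRj cc U hcc hcle hU hU3 β hβmin hβc μ hμ K hfr (R.Gfr 3 * U ^ 2 * ((4 : ℝ) ^ (N + 1) / 3)) hA3 L M hLβ hMβ
      (k + 1) (by omega) (by omega) hdat ω a'
    exact le_trans hbd hmonoD
  · -- below the window: the character-sum telescope from the base index, read at `K_n` through the model congruence
    obtain ⟨m₀, hm1, hmn, hdepth, hwin₀⟩ := exists_overlap_base_index_of_not_window hU1 hn1 hwin
    have h := htel G P Q cc hR2 hcc hcc6 μ hμ U hU hUle hcU β hβmin hβc L M hL3 hM3 n hnN hreg hhist hosc m₀ hm1 hmn k hdepth hwin₀ ω a'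
    have hK : ∀ q : TorusSite 2 L,
        (fsub (klFlowFrameU L M β U μ n) (symInterp L fun _ =>
            ∑ m ∈ Ico n n, klAngularMean (klLocalPart L M β U μ (klFlowFrameU L M β U μ m) m))).eval (latticeMomentum L q) =
          (klFlowFrameU L M β U μ n).eval (latticeMomentum L q) := fun q =>
      eval_fsub_symInterp_sum_Ico_self _ _ n _
    have hfam1 := klAnisoFamily_congr L M hK β μ klE0 (k + 1)
    have hfam0 := klAnisoFamily_congr L M hK β μ klE0 k
    rw [hfam1, hfam0] at h
    exact h.trans hmonoT

/-! ## §2 The general-jump weighted overlap constants at the flow frame, no window -/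

set_option maxHeartbeats 1600000 in -- long regime bookkeeping
/-- **The WEIGHTED overlap constants of `E(klAnisoFamily J′)·S(F̃_k)` at the flow frame `K_n`, in the KL regime, NO depth window** (see the module docstring):
the window-free twin of `overlapWt_jump_sums_klEng_flow_deep`; one constant per `(R, c″)`.
[cite: BenfattoGiulianiMastropietro2006, §2.7 (2.71a), §2.8 (2.77), (2.82)–(2.83)] -/
theorem overlapWt_jump_sums_klEng_flow_all (R : RenConsts) (c'' : ℝ) (hc'' : 0 ≤ c'') :
    ∃ CJ : ℝ, 0 < CJ ∧
      ∀ (G : GeoConsts) (P : SplitConsts) (Q : EngConsts) (cc : ℝ), R.WF2 → 0 < cc → cc ≤ EngineV8.klEngC₃6 P R →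
      ∀ μ ∈ klWindowC, ∀ U : ℝ, 0 < U → U ≤ min (EngineV8.klEngU₀3 P R cc) (1 / (R.Gfr 3 + 1)) → c'' * U ≤ 1 →
      ∀ β : ℝ, klBetaMin ≤ β → β ≤ Real.exp (cc / U ^ 2) →
      ∀ (L M : ℕ) [NeZero L] [NeZero M], EngineV8.klEngL₃ β U ≤ L → EngineV8.klEngM₃ β U L ≤ M →
      ∀ n : ℕ, 1 ≤ n → n ≤ nScales β + 1 → IsKLRegime U cc (-(n : ℤ)) → HistP klPredsV17F2 L M G P Q R β U μ 0 n →
        (∀ m, 1 ≤ m → m < n → FlowPieceOscAt L M c'' β U μ m) →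
        ∀ k J' : ℕ, k + 1 ≤ J' → J' ≤ n →
        (∀ X'' : SpaceTimeIdx L M × SectorLeg (sectorCount J'),
          ∑ X', ‖(sectorAnalysisMatrix L M β (klAnisoFamily L M β μ (klFlowFrameU L M β U μ n) klE0 J') *
            sectorSubMatrix L M β (bgmFatMultiplier L M klE0 β (nambuXiCT L μ (klFlowFrameU L M β U μ n)) k)) X'' X'‖ *
              EngineV8.klScaleWt L M β J' {EngineV8.latticeLegPos (2 * (2 * M)) X'', EngineV8.latticeLegPos (2 * (2 * M)) X'} ≤
            81 * CJ * M / β) ∧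
        (∀ (ω'' : Fin (sectorCount J')) (ω' : Fin (sectorCount k)) (σ c : Fin 2) (x' : SpaceTimeIdx L M),
          ∑ x'' : SpaceTimeIdx L M, ‖(sectorAnalysisMatrix L M β (klAnisoFamily L M β μ (klFlowFrameU L M β U μ n) klE0 J') *
            sectorSubMatrix L M β (bgmFatMultiplier L M klE0 β (nambuXiCT L μ (klFlowFrameU L M β U μ n)) k))
              (x'', ((ω'', σ), c)) (x', ((ω', σ), c))‖ *
              EngineV8.klScaleWt L M β J'
                {EngineV8.latticeLegPos (2 * (2 * M)) ((x'', ((ω'', σ), c)) : SpaceTimeIdx L M × SectorLeg (sectorCount J')),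
                  EngineV8.latticeLegPos (2 * (2 * M)) ((x', ((ω', σ), c)) : SpaceTimeIdx L M × SectorLeg (sectorCount k))} ≤
            3 * CJ * M / β) ∧
        (∀ (ω'' : Fin (sectorCount J')) (ω' : Fin (sectorCount k)) (σ c : Fin 2) (x'' : SpaceTimeIdx L M),
          ∑ x' : SpaceTimeIdx L M, ‖(sectorAnalysisMatrix L M β (klAnisoFamily L M β μ (klFlowFrameU L M β U μ n) klE0 J') *
            sectorSubMatrix L M β (bgmFatMultiplier L M klE0 β (nambuXiCT L μ (klFlowFrameU L M β U μ n)) k))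
              (x'', ((ω'', σ), c)) (x', ((ω', σ), c))‖ *
              EngineV8.klScaleWt L M β J'
                {EngineV8.latticeLegPos (2 * (2 * M)) ((x'', ((ω'', σ), c)) : SpaceTimeIdx L M × SectorLeg (sectorCount J')),
                  EngineV8.latticeLegPos (2 * (2 * M)) ((x', ((ω', σ), c)) : SpaceTimeIdx L M × SectorLeg (sectorCount k))} ≤
            3 * CJ * M / β) := by
  obtain ⟨CT, hCT, h⟩ := charSumWt_nbPair_klEng_flow_all R c'' hc''
  refine ⟨CT + 729 * CT ^ 2 / 2, by positivity, ?_⟩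
  intro G P Q cc hR2 hcc hcc6 μ hμ U hU hUle hcU β hβmin hβc L M _ _ hL3 hM3 n hn1 hnN hreg hhist hosc k J' hJ hJn
  have hβ0 : 0 < β := pos_of_klBetaMin_le hβmin
  have hL0 : (0 : ℝ) < L := Nat.cast_pos.2 (Nat.pos_of_ne_zero (NeZero.ne L))
  have hM0 : (0 : ℝ) < M := Nat.cast_pos.2 (Nat.pos_of_ne_zero (NeZero.ne M))
  set K : TrigPolyC4v := klFlowFrameU L M β U μ n with hKdef
  -- the weighted neighbouring bounds on the window `[k + 1, J′]`, weight scale `J′` (dominated by each level's own rate)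
  have hT : ∀ m : ℕ, k + 1 ≤ m → m ≤ J' → ∀ (ω : Fin (sectorCount m)) (a' : Fin (sectorCount (m - 1))),
      ∑ z : TorusSite 1 (2 * M) × TorusSite 2 L,
        (1 + klScale klE0 J' * β / (2 * M) * |(((z.1 0).valMinAbs : ℤ) : ℝ)| + klScale klE0 J' * |(((z.2 0).valMinAbs : ℤ) : ℝ)| +
            klScale klE0 J' * |(((z.2 1).valMinAbs : ℤ) : ℝ)|) *
        ‖∑ q : TorusSite 1 (2 * M) × TorusSite 2 L, (torusChar q.1 z.1 * torusChar q.2 z.2) •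
          (klAnisoFamily L M β μ K klE0 m ω (⟨(q.1 0).val, ZMod.val_lt (q.1 0)⟩, q.2) *
            klAnisoFamily L M β μ K klE0 (m - 1) a' (⟨(q.1 0).val, ZMod.val_lt (q.1 0)⟩, q.2))‖ ≤ CT * M * (L : ℝ) ^ 2 := by
    intro m hkm hmJ ω a'
    obtain ⟨k₁, rfl⟩ : ∃ k₁, m = k₁ + 1 := ⟨m - 1, by omega⟩
    have hbd := h G P Q cc hR2 hcc hcc6 μ hμ U hU hUle hcU β hβmin hβc L M hL3 hM3 n hn1 hnN hreg hhist hosc k₁ (by omega) ω a'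
    refine le_trans (sum_le_sum fun z _ => mul_le_mul_of_nonneg_right ?_ (norm_nonneg _)) hbd
    have hΛle : klScale klE0 J' ≤ klScale klE0 (k₁ + 1) := EngineV8.klScale_le_klScale (by norm_num [klE0]) hmJ
    have h0 : 0 ≤ |(((z.1 0).valMinAbs : ℤ) : ℝ)| := abs_nonneg _
    have h1 : 0 ≤ |(((z.2 0).valMinAbs : ℤ) : ℝ)| := abs_nonneg _
    have h2 : 0 ≤ |(((z.2 1).valMinAbs : ℤ) : ℝ)| := abs_nonneg _
    have hβM : 0 ≤ β / (2 * M) := by positivity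
    have hΛ0 : 0 ≤ klScale klE0 J' := (klth_klScale_pos J').le
    have ht : klScale klE0 J' * β / (2 * M) ≤ klScale klE0 (k₁ + 1) * β / (2 * M) := by
      rw [mul_div_assoc, mul_div_assoc]; exact mul_le_mul_of_nonneg_right hΛle hβM
    gcongr
  -- the windowed jump package and the constants
  have hT0 : 0 ≤ CT * M * (L : ℝ) ^ 2 := by positivity
  obtain ⟨hrow, hcol₁, hrow₁⟩ := overlapWt_jump_sums_le_of_nbWindow (L := L) (M := M) hβ0 μ K (n₀ := k + 1) hT0 hT le_rfl hJ
  have eTJ : CT * M * (L : ℝ) ^ 2 + 729 * ((((2 * M : ℕ) : ℝ) ^ 1 * (L : ℝ) ^ 2)⁻¹ * (CT * M * (L : ℝ) ^ 2) ^ 2) =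
      (CT + 729 * CT ^ 2 / 2) * M * (L : ℝ) ^ 2 := by
    push_cast
    field_simp
  have e81 : ((27 : ℕ) : ℝ) * (3 * ((CT + 729 * CT ^ 2 / 2) * M * (L : ℝ) ^ 2) / (β * (L : ℝ) ^ 2)) =
      81 * (CT + 729 * CT ^ 2 / 2) * M / β := by
    push_cast
    field_simp
    ring
  have e3 : 3 * ((CT + 729 * CT ^ 2 / 2) * M * (L : ℝ) ^ 2) / (β * (L : ℝ) ^ 2) = 3 * (CT + 729 * CT ^ 2 / 2) * M / β := by
    field_simp
  refine ⟨fun X'' => ?_, fun ω'' ω' σ c x' => ?_, fun ω'' ω' σ c x'' => ?_⟩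
  · have h1 := hrow X''
    rw [eTJ, e81] at h1
    exact h1
  · have h1 := hcol₁ ω'' ω' σ c x'
    rw [eTJ, e3] at h1
    exact h1
  · have h1 := hrow₁ ω'' ω' σ c x''
    rw [eTJ, e3] at h1
    exact h1

end Summit.HubbardSuperconductivity.HubbardSuperconductivity.Theorems.TorusFourierL2

end
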